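import Summits.QuantumFields.BalabanUV.T4Continuum.Support.NE7TangentTransportGauge
import Summits.QuantumFields.BalabanUV.T4Continuum.Support.NE3RightInverseLetters
import Summits.QuantumFields.BalabanUV.T4Continuum.Support.NE7OneStepLetters
import Summits.QuantumFields.BalabanUV.T4Continuum.Support.AveragingDeficitMultiLevelBridge
import HarnessLib

/-!
# NE7TangentTransportRightInv — F52's gauge-corrected test-field transport INSTANTIATED with row NE3's exact curved right inverse `rightInvW` (W5):
# F38∕F44's letter `hTT` AT A REPRESENTATIVE WITH FLAT TOP AVERAGE, from ONE displayed letter — the straight-tower bound (TT-Q) `Λ` (F50∕F51) —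
# with `τ = a·(curl1C∕(1−θℓ))·(M^d∕M²)·Λ` (so `τ ∼ δα̂M⁻³` when `Λ ∼ α̂M^{1−d}`, `a = δM⁻²`)

Cell `pub-balaban`, rung (B)+1 sub-cell t4, lineage `b2b-balaban-t4-ne7-p1`, generation 71 (CRUX PROVER NE7 #1); memo
`t4/b2b-balaban-t4-ne7-p1-g71/HUNT-H15-EXP-LANDED-TT-CURRENCY.md` §2, §7.  File F53 (over F52 `NE7TangentTransportGauge.tangent_transport_gauge` (the transport with
an ABSTRACT right inverse), row NE3 leaf-01's `NE3RightInverseLetters` (`rightInvW_exact`, `rightInvW_skew`, `rightInvW_periodic`, (R3) `sum_norm_curl_rightInvW_le`),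
F3 `NE7OneStepLetters.abs_dAction_le_radius_mul`, `AveragingDeficitMultiLevelBridge.tower_eq`) — the chain of F41 `NE7TangentTransport.tangent_correction` §1,
now feeding F52 instead of F41's frame-carrying letter.
WHY (memo H15 §1–§2).  F41's `hTT_of_dirL1_letter` asked `‖D_U Y‖_{ℓ¹} ≤ Λ‖Y‖₁`, whose honest `Λ` is `≈ dLα̂M⁻¹` (the frames) — two powers of `M` short.  F52
transports by `Y′ = Y + gaugeDir_U λ − R(D_U(Y + gaugeDir_U λ))` and pays only the STRAIGHT tower `Q̄^{(k+1)}_U − Q^{(k+1)}`; THIS FILE plugs in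
`R := rightInvW` (through a classical case split on skewness, so that `R` is a plain function) and the (R3) + F3 first-variation bound
`|dAction U (rightInvW φ)| ≤ a·(curl1C∕(1−θℓ))·(M^d∕M²)·‖φ‖_{ℓ¹(periodBox N)}`, and delivers F38∕F44's `hTT` VERBATIM (period spelt `N·L^{k+1}`).
WHAT ([folklore]; 0 def, 0 sorry).  §1 `abs_dAction_rightInvW_le` (the first-variation bound of the right inverse, (R3) + F3).  §2 **`hTT_gauge_of_towerLetter`**:
under F41's hypotheses on `U` (unitary, `(N·L^{k+1})`-periodic, class radius `x` in the W5∕W6 regime, `SmallField U a`) PLUS the top normalisation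
`cavgIter L (k+1) U = 1` and the straight-tower letter `Λ` on skew periodic `Y`: every skew periodic `Y` tangent at `1` has a skew periodic `Y′` tangent at
`U` with `|dAction U (Y′ − Y) (perWin d (N·L^{k+1}))| ≤ (a·(curl1C∕(1−θℓ))·(M^d∕M²)·Λ)·dirL1 Y (periodBox (N·L^{k+1}))`.
HONEST FRAMING (page 1): assembly of tree theorems; `Λ` (F51 at the trivial datum) and the top normalisation are hypotheses here; (APE) NOT proved; NOT
ONE-STEP, NOT NE7; spine 0∕9; finite T⁴ rung (B)+1 — NOT infinite volume, NOT mass gap, NOT Clay.  Continuum YM on T⁴ ⇐ BetaPertH ∧ nine spine estimates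
(0/9 proved); BetaPertH ⇐ (D1) ∧ (D4) ∧ CAP+tail; G-an2-4 gates asym, D1 and NE2/3/4.
-/

set_option autoImplicit false

open scoped BigOperators Matrix.Norms.L2Operator
open NormedSpace Finset

namespace Summit.QuantumFields.BalabanUV.T4Continuum.NE7TangentTransportRightInv

open Literature.MathematicalPhysics.QuantumFieldTheory.Balaban1983to89
open B7Prop1Explicit B7Prop2Explicit MatrixLog UnitaryModel
open T4AveragingDeficitWall (IsUnitaryCfg IsSkewDir SmallField curl dirL1)
open T4AveragingDeficitWallBoundary (IsPeriodicCfg periodBox)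
open AveragingDeficitPeriodicCounting (IsPeriodicDir)
open AveragingDeficitMultiLevelPrep (cavgIter LevelSmall tower)
open AveragingDeficitMultiLevelBridge (tower_eq)
open MinimalActionLevels (perWin)
open BlockAveragePushDirSplit (flat)
open NE3HessForm (dAction)
open NE3TangentCovariantTower (dirIter QbarIter)
open NE3QbarIterCovLiftPrep (cruxC)
open NE3SmoothRightInverseW (rightInvW)
open NE3RightInverseSolveLetters (thetaLoc)
open NE3HatInvCurlLetters (curl1C curl1C_nonneg)
open NE3RightInverseLetters (rightInvW_exact rightInvW_skew rightInvW_periodic sum_norm_curl_rightInvW_le)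
open NE7OneStepLetters (abs_dAction_le_radius_mul)
open NE7TangentTransportGauge (tangent_transport_gauge)

noncomputable section

variable {d : ℕ} {n : Type*} [Fintype n] [DecidableEq n]

/-! ## §1 The first-variation bound of the exact curved right inverse ((R3) + F3) -/

/-- **`|dAction U (rightInvW … φ) (perWin d (N·L^{k+1}))| ≤ a·(curl1C∕(1−θℓ))·(M^d∕M²)·‖φ‖_{ℓ¹(periodBox N)}`** for `U` as in F41 §1 with `SmallField U a`
and a skew coarse `φ` (F3: `|dAction U Z| ≤ a·Σ‖curl U Z‖`; (R3): the window curl sum of the right inverse). [folklore] -/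
theorem abs_dAction_rightInvW_le [Nonempty n] {L : ℕ} (hL : 2 ≤ L) (k : ℕ) {N : ℕ} [NeZero N] {U : Site d → Fin d → (Matrix n n ℂ)ˣ} {x a : ℝ}
    (hUu : IsUnitaryCfg U) (hUP : IsPeriodicCfg U ((tower L N (k + 1) : ℕ) : ℤ)) (hx : 0 ≤ x) (hs : LevelSmall d L k x) (hUx : SmallField U x)
    (hθ : cruxC d L * (((L : ℝ) ^ (k + 1)) ^ 2 * x) < 1) (hθl : thetaLoc d L * (((L : ℝ) ^ (k + 1)) ^ 2 * x) < 1)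
    (hε : ((L : ℝ) ^ (k + 1)) ^ 2 * x ≤ 1) (ha : 0 ≤ a) (hUa : SmallField U a)
    {φ : Site d → Fin d → Matrix n n ℂ} (hφ : IsSkewDir φ) :
    |dAction U (rightInvW hL k hUu hx hs hUx N hθ hφ) (perWin d (N * L ^ (k + 1)))|
      ≤ (a * ((curl1C d L / (1 - thetaLoc d L * (((L : ℝ) ^ (k + 1)) ^ 2 * x))) * (((L : ℝ) ^ (k + 1)) ^ d / ((L : ℝ) ^ (k + 1)) ^ 2)))
        * dirL1 φ (periodBox (d := d) N) := by
  have hZs : IsSkewDir (rightInvW hL k hUu hx hs hUx N hθ hφ) := rightInvW_skew hL k hUu hx hs hUx hθ hφ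
  have h3 := abs_dAction_le_radius_mul hUu hZs hUa (perWin d (N * L ^ (k + 1)))
  have hR3 := sum_norm_curl_rightInvW_le hL k hUu hUP hx hs hUx hθ hθl hε hφ
  refine h3.trans ?_
  have h4 := mul_le_mul_of_nonneg_left hR3 ha
  simpa only [mul_assoc] using h4

/-! ## §2 F38∕F44's `hTT` from the straight-tower letter, at a representative with flat top average -/

/-- **(TT) OF F38's BUNDLE FROM THE STRAIGHT-TOWER LETTER (TT-Q).**  Under F41 §1's hypotheses on the representative `U` (unitary,
`(N·L^{k+1})`-periodic, class radius `x ≥ 0` with `LevelSmall d L k x`, the W5∕W6 regime `cruxC·M²x < 1`, `thetaLoc·M²x < 1`, `M²x ≤ 1`, `SmallField U a`,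
`a ≥ 0`), the TOP NORMALISATION `cavgIter L (k+1) U = 1`, and the letter
`hΛ : Σ_{z∈[0,N)^d}Σ_κ ‖QbarIter (k+1) U Y − QbarIter (k+1) 1 Y‖ ≤ Λ·‖Y‖_{ℓ¹(periodBox (N·L^{k+1}))}` for skew periodic `Y` (F51 at `U = e^{A}`):
F38's hypothesis `hTT` holds with `τ = a·(curl1C∕(1−θℓ))·(M^d∕M²)·Λ` — F52 `tangent_transport_gauge` with `R := rightInvW` and §1. [folklore] -/
theorem hTT_gauge_of_towerLetter [Nonempty n] {L : ℕ} (hL : 2 ≤ L) (k : ℕ) {N : ℕ} [NeZero N] {U : Site d → Fin d → (Matrix n n ℂ)ˣ} {x a Λ : ℝ}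
    (hUu : IsUnitaryCfg U) (hUP : IsPeriodicCfg U ((N * L ^ (k + 1) : ℕ) : ℤ)) (hx : 0 ≤ x) (hs : LevelSmall d L k x) (hUx : SmallField U x)
    (hθ : cruxC d L * (((L : ℝ) ^ (k + 1)) ^ 2 * x) < 1) (hθl : thetaLoc d L * (((L : ℝ) ^ (k + 1)) ^ 2 * x) < 1)
    (hε : ((L : ℝ) ^ (k + 1)) ^ 2 * x ≤ 1) (ha : 0 ≤ a) (hUa : SmallField U a)
    (hflatTop : cavgIter L (k + 1) U = flat)
    (hΛ : ∀ Y : Site d → Fin d → Matrix n n ℂ, IsSkewDir Y → IsPeriodicDir Y ((N * L ^ (k + 1) : ℕ) : ℤ) →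
      ∑ z ∈ periodBox N, ∑ κ : Fin d, ‖QbarIter L (k + 1) U Y z κ - QbarIter L (k + 1) (flat (d := d) (n := n)) Y z κ‖
        ≤ Λ * dirL1 Y (periodBox (d := d) (N * L ^ (k + 1)))) :
    ∀ Y : Site d → Fin d → Matrix n n ℂ, IsSkewDir Y → IsPeriodicDir Y ((N * L ^ (k + 1) : ℕ) : ℤ) →
      dirIter L (k + 1) (flat (d := d) (n := n)) Y = 0 →
      ∃ Y' : Site d → Fin d → Matrix n n ℂ, IsSkewDir Y' ∧ IsPeriodicDir Y' ((N * L ^ (k + 1) : ℕ) : ℤ) ∧ dirIter L (k + 1) U Y' = 0 ∧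
        |dAction U (fun y μ => Y' y μ - Y y μ) (perWin d (N * L ^ (k + 1)))|
          ≤ ((a * ((curl1C d L / (1 - thetaLoc d L * (((L : ℝ) ^ (k + 1)) ^ 2 * x))) * (((L : ℝ) ^ (k + 1)) ^ d / ((L : ℝ) ^ (k + 1)) ^ 2))) * Λ)
            * dirL1 Y (periodBox (d := d) (N * L ^ (k + 1))) := by
  classical
  have hL1 : 1 ≤ L := le_trans (by norm_num) hL
  have htowN : tower L N (k + 1) = N * L ^ (k + 1) := tower_eq L N (k + 1)
  have htow : ((tower L N (k + 1) : ℕ) : ℤ) = ((N * L ^ (k + 1) : ℕ) : ℤ) := by rw [htowN]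
  have hUP' : IsPeriodicCfg U ((tower L N (k + 1) : ℕ) : ℤ) := by rw [htow]; exact hUP
  -- the right inverse as a plain function (classical case split on skewness)
  set R : (Site d → Fin d → Matrix n n ℂ) → Site d → Fin d → Matrix n n ℂ :=
    fun φ => if h : IsSkewDir φ then rightInvW hL k hUu hx hs hUx N hθ h else 0 with hR
  have hRdef : ∀ φ : Site d → Fin d → Matrix n n ℂ, ∀ h : IsSkewDir φ, R φ = rightInvW hL k hUu hx hs hUx N hθ h := fun φ h => by
    simp only [hR, dif_pos h]
  set cR : ℝ := a * ((curl1C d L / (1 - thetaLoc d L * (((L : ℝ) ^ (k + 1)) ^ 2 * x))) * (((L : ℝ) ^ (k + 1)) ^ d / ((L : ℝ) ^ (k + 1)) ^ 2))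
    with hcR
  have hcR0 : 0 ≤ cR := by
    have hpos : 0 < 1 - thetaLoc d L * (((L : ℝ) ^ (k + 1)) ^ 2 * x) := by linarith
    have := curl1C_nonneg d L
    rw [hcR]; positivity
  -- the four letters of `R`
  have hRskew : ∀ φ : Site d → Fin d → Matrix n n ℂ, IsSkewDir φ → IsPeriodicDir φ (N : ℤ) → IsSkewDir (R φ) := fun φ hφ _ => by
    rw [hRdef φ hφ]; exact rightInvW_skew hL k hUu hx hs hUx hθ hφ
  have hRper : ∀ φ : Site d → Fin d → Matrix n n ℂ, IsSkewDir φ → IsPeriodicDir φ (N : ℤ) →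
      IsPeriodicDir (R φ) ((tower L N (k + 1) : ℕ) : ℤ) := fun φ hφ _ => by
    rw [hRdef φ hφ, htow]; exact rightInvW_periodic hL k hUu hUP' hx hs hUx hθ hφ
  have hRexact : ∀ φ : Site d → Fin d → Matrix n n ℂ, IsSkewDir φ → IsPeriodicDir φ (N : ℤ) → dirIter L (k + 1) U (R φ) = φ := fun φ hφ hφP => by
    rw [hRdef φ hφ]; exact rightInvW_exact hL k hUu hUP' hx hs hUx hθ hφ hφP
  have hRbd : ∀ φ : Site d → Fin d → Matrix n n ℂ, IsSkewDir φ → IsPeriodicDir φ (N : ℤ) →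
      |dAction U (R φ) (perWin d (tower L N (k + 1)))| ≤ cR * dirL1 φ (periodBox (d := d) N) := fun φ hφ hφP => by
    rw [hRdef φ hφ, htowN]
    exact abs_dAction_rightInvW_le hL k hUu hUP' hx hs hUx hθ hθl hε ha hUa hφ
  -- the tower letter in `tower` spelling
  have hΛ' : ∀ Y : Site d → Fin d → Matrix n n ℂ, IsSkewDir Y → IsPeriodicDir Y ((tower L N (k + 1) : ℕ) : ℤ) →
      ∑ z ∈ periodBox N, ∑ κ : Fin d, ‖QbarIter L (k + 1) U Y z κ - QbarIter L (k + 1) (flat (d := d) (n := n)) Y z κ‖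
        ≤ Λ * dirL1 Y (periodBox (d := d) (tower L N (k + 1))) := fun Y hY hYP => by
    rw [htowN]; rw [htow] at hYP; exact hΛ Y hY hYP
  -- F52
  intro Y hY hYP hYT
  have hYP' : IsPeriodicDir Y ((tower L N (k + 1) : ℕ) : ℤ) := by rw [htow]; exact hYP
  obtain ⟨Y', hY's, hY'P, hY'T, hY'd⟩ :=
    tangent_transport_gauge hL1 k hUu hUP' hx hs hUx hflatTop R hRskew hRper hRexact hcR0 hRbd hΛ' Y hY hYP' hYT
  refine ⟨Y', hY's, by rw [← htow]; exact hY'P, hY'T, ?_⟩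
  rw [← htowN]
  simpa only [hcR] using hY'd

end

end Summit.QuantumFields.BalabanUV.T4Continuum.NE7TangentTransportRightInv
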